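import Literature.LinearAlgebra.Matrix.LatimerMacDuffee
import Mathlib.LinearAlgebra.Matrix.ToLinearEquiv
import HarnessLib

/-!
# The Latimer–MacDuffee–Taussky correspondence: the module of a matrix is an ideal, and
# isomorphic modules are exactly conjugate matrices

Topic `LinearAlgebra/Matrix`, namespace `Literature.LinearAlgebra.Matrix`; continuation of
`LatimerMacDuffee.lean` (which treats the class-number-one case). Source: O. Taussky, *On a
theorem of Latimer and MacDuffee*, Canad. J. Math. 1 (1949) 300–302 [Taussky1949], Theorems 1–3;
C. G. Latimer, C. C. MacDuffee, Ann. of Math. 34 (1933) 313–316 [LatimerMacduffee1933].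

Let `f ∈ ℤ[X]` be monic of degree `n ≥ 1` with `S = ℤ[X]/(f) = ℤ[α]` an integral domain, and let
`A ∈ Mₙ(ℤ)` satisfy `f(A) = 0`, with its `S`-module `ℤⁿ_A` (`QuotModule f A hA`: `ℤⁿ` with `α`
acting as `A`). This file proves the three structural facts of the correspondence that are needed
to pass between matrix classes and ideal classes in general (i.e. beyond class number one):

* `QuotModule.lift`: an additive map `g : ℤⁿ → N` into an `S`-module with `g (A v) = α • g v` is
  `S`-linear on `ℤⁿ_A` (Taussky: "`α(ω₁, …, ωₙ) = X(ω₁, …, ωₙ)`" determines the module).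
* `QuotModule.exists_linearEquiv_ideal` (**Taussky's Theorem 1**: "to every matrix solution `X`
  of `f(X) = 0` corresponds an ideal `𝔞` of `ℤ[α]` such that `α ωᵢ = Σ xᵢₖ ωₖ` for a basis
  `ω₁, …, ωₙ` of `𝔞`"): `ℤⁿ_A ≅ J` for a nonzero ideal `J ⊆ S`. Proof: `s ↦ s • e₀` embeds `S`
  into `ℤⁿ_A` (torsion-freeness), with image of finite index `d = det (e₀, A e₀, …, Aⁿ⁻¹ e₀) ≠ 0`
  (a vanishing determinant would give `p(A) e₀ = 0` with `0 ≠ p`, `deg p < n`, i.e. a torsion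
  element), so `m ↦ (s ↦ s • e₀)⁻¹ (d m)` embeds `ℤⁿ_A` into `S`.
* `QuotModule.exists_isUnit_det_of_linearEquiv` / `QuotModule.linearEquivOfConj` (**Taussky's
  Theorems 2–3**: matrices in the same class `S⁻¹ A S`, `det S = ±1`, correspond to the same
  ideal class and conversely): `ℤⁿ_A ≅ ℤⁿ_B` as `S`-modules iff `P A = B P` for a unimodular
  integer matrix `P`.
* `linearEquivOfSpanSingletonMulEq`: ideals in the same class, `(x) I = (y) J`, are isomorphic
  `S`-modules; `QuotModule.injective_of_ne_zero`: a non-zero `S`-linear map `ℤⁿ_A → S` is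
  injective (as `ℤⁿ_A` is isomorphic to an ideal of the domain `S`); `QuotModule.toRing`: the
  `S`-linear map `ℤⁿ_A → S` attached to elements `β₁, …, βₙ ∈ S` with `α βⱼ = Σᵢ Aᵢⱼ βᵢ`.

## Not here

Any class-number computation; the finiteness of the number of classes.
-/

open Polynomial

noncomputable section

namespace Literature.LinearAlgebra.Matrix

variable {n : ℕ}

namespace QuotModule

variable {f : ℤ[X]} {A B : _root_.Matrix (Fin n) (Fin n) ℤ} {hA : aeval A f = 0}
  {hB : aeval B f = 0}

/-! ### Polynomials act as matrix polynomials -/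

/-- The class of `p` acts on `ℤⁿ_A` as `p(A)`: `[p] • v = p(A) v`. [cite: Taussky1949, Theorem 3] -/
theorem mk_smul_of (p : ℤ[X]) (v : Fin n → ℤ) :
    AdjoinRoot.mk f p • of f A hA v = of f A hA ((aeval A p).mulVec v) := by
  rw [mk_smul]
  exact PolyModule.smul_of A p v

/-- Powers of the root act as powers of `A`. [folklore] -/
theorem root_pow_smul_of (k : ℕ) (v : Fin n → ℤ) :
    AdjoinRoot.root f ^ k • of f A hA v = of f A hA ((A ^ k).mulVec v) := by
  rw [AdjoinRoot.root, ← map_pow, mk_smul_of, aeval_X_pow]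

/-- `of` is injective (it is the identity on elements). [folklore] -/
theorem of_ne_zero {v : Fin n → ℤ} (hv : v ≠ 0) : of f A hA v ≠ 0 :=
  fun h => hv ((of f A hA).map_eq_zero_iff.mp h)

/-! ### `S`-linear maps out of `ℤⁿ_A` -/

/-- An additive map `g : ℤⁿ → N` with `g (A v) = α • g v` intertwines `p(A)` with `[p]` for every
polynomial `p`. [cite: Taussky1949, Theorem 3 (proof)] -/
theorem map_aeval_mulVec {N : Type*} [AddCommGroup N] [Module (AdjoinRoot f) N]
    (g : (Fin n → ℤ) →+ N) (hg : ∀ v, g (A.mulVec v) = AdjoinRoot.root f • g v)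
    (p : ℤ[X]) (v : Fin n → ℤ) :
    g ((aeval A p).mulVec v) = AdjoinRoot.mk f p • g v := by
  induction p using Polynomial.induction_on generalizing v with
  | C a =>
    rw [aeval_C, Algebra.algebraMap_eq_smul_one, Matrix.smul_mulVec, Matrix.one_mulVec,
      map_zsmul, AdjoinRoot.mk_C]
    change a • g v = (algebraMap ℤ (AdjoinRoot f) a) • g v
    rw [algebraMap_smul]
  | add p q hp hq =>
    rw [map_add, Matrix.add_mulVec, map_add, hp, hq, map_add, add_smul]
  | monomial k a ih =>
    rw [pow_succ, ← mul_assoc, map_mul _ (C a * X ^ k) X, aeval_X, ← Matrix.mulVec_mulVec,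
      ih (A.mulVec v), hg, smul_smul, ← AdjoinRoot.mk_X, ← map_mul]

/-- **`S`-linear maps out of `ℤⁿ_A`.** An additive map `g : ℤⁿ → N` into an `S = ℤ[X]/(f)`-module
with `g (A v) = α • g v` is `S`-linear as a map on `ℤⁿ_A` (the module structure is determined by
the action of `α`; Taussky 1949: "`α(ω₁, …, ωₙ) = X(ω₁, …, ωₙ)`"). [cite: Taussky1949, Theorem 3] -/
def lift {N : Type*} [AddCommGroup N] [Module (AdjoinRoot f) N]
    (g : (Fin n → ℤ) →+ N) (hg : ∀ v, g (A.mulVec v) = AdjoinRoot.root f • g v) :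
    QuotModule f A hA →ₗ[AdjoinRoot f] N where
  toFun m := g ((of f A hA).symm m)
  map_add' x y := by simp
  map_smul' s m := by
    obtain ⟨p, rfl⟩ := AdjoinRoot.mk_surjective s
    obtain ⟨v, rfl⟩ := (of f A hA).surjective m
    rw [mk_smul_of, LinearEquiv.symm_apply_apply, LinearEquiv.symm_apply_apply,
      RingHom.id_apply]
    exact map_aeval_mulVec g hg p v

/-- `lift g hg` is `g` on elements. [folklore] -/
@[simp] theorem lift_of {N : Type*} [AddCommGroup N] [Module (AdjoinRoot f) N]
    (g : (Fin n → ℤ) →+ N) (hg : ∀ v, g (A.mulVec v) = AdjoinRoot.root f • g v)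
    (v : Fin n → ℤ) : lift (hA := hA) g hg (of f A hA v) = g v := by
  change g ((of f A hA).symm (of f A hA v)) = g v
  rw [LinearEquiv.symm_apply_apply]

/-! ### Conjugate matrices have isomorphic modules, and conversely -/

/-- `P A = B P` implies `P p(A) = p(B) P`. [folklore] -/
theorem mul_aeval_eq_aeval_mul {P : _root_.Matrix (Fin n) (Fin n) ℤ} (hP : P * A = B * P)
    (p : ℤ[X]) : P * aeval A p = aeval B p * P := by
  induction p using Polynomial.induction_on with
  | C a =>
    rw [aeval_C, aeval_C, Algebra.algebraMap_eq_smul_one, Matrix.mul_smul, Matrix.smul_mul,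
      mul_one, one_mul]
  | add p q hp hq => rw [map_add, map_add, mul_add, add_mul, hp, hq]
  | monomial k a ih =>
    rw [pow_succ, ← mul_assoc, map_mul _ (C a * X ^ k) X, map_mul _ (C a * X ^ k) X, aeval_X,
      aeval_X, ← mul_assoc, ih, mul_assoc, hP, ← mul_assoc]

/-- **Conjugate matrices give isomorphic modules** (Taussky's Theorem 3: "the matrices which
correspond to [bases of] the same ideal class … are of the form `S⁻¹ A S`", the easy direction):
if `P A = B P` with `P` unimodular then `v ↦ P v` is an `S`-isomorphism `ℤⁿ_A ≅ ℤⁿ_B`. [cite: Taussky1949, Theorem 3] -/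
def linearEquivOfConj (P : _root_.Matrix (Fin n) (Fin n) ℤ) (hPdet : IsUnit P.det)
    (hP : P * A = B * P) : QuotModule f A hA ≃ₗ[AdjoinRoot f] QuotModule f B hB := by
  refine LinearEquiv.ofBijective
    (lift (((of f B hB : (Fin n → ℤ) →ₗ[ℤ] QuotModule f B hB) : (Fin n → ℤ) →+ QuotModule f B hB).comp
      (Matrix.mulVecLin P).toAddMonoidHom) fun v => ?_) ⟨?_, ?_⟩
  · change of f B hB (P.mulVec (A.mulVec v)) = AdjoinRoot.root f • of f B hB (P.mulVec v)
    rw [root_smul_of, Matrix.mulVec_mulVec, Matrix.mulVec_mulVec, hP]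
  · intro x y hxy
    obtain ⟨v, rfl⟩ := (of f A hA).surjective x
    obtain ⟨w, rfl⟩ := (of f A hA).surjective y
    rw [lift_of, lift_of] at hxy
    change of f B hB (P.mulVec v) = of f B hB (P.mulVec w) at hxy
    have h := (of f B hB).injective hxy
    have h' : (P⁻¹ * P).mulVec v = (P⁻¹ * P).mulVec w := by
      rw [← Matrix.mulVec_mulVec, ← Matrix.mulVec_mulVec, h]
    rwa [Matrix.nonsing_inv_mul _ hPdet, Matrix.one_mulVec, Matrix.one_mulVec] at h'
  · intro y
    obtain ⟨w, rfl⟩ := (of f B hB).surjective y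
    refine ⟨of f A hA (P⁻¹.mulVec w), ?_⟩
    rw [lift_of]
    change of f B hB (P.mulVec (P⁻¹.mulVec w)) = of f B hB w
    rw [Matrix.mulVec_mulVec, Matrix.mul_nonsing_inv _ hPdet, Matrix.one_mulVec]

/-- **Isomorphic modules give conjugate matrices** (Taussky's Theorem 2/3, the other direction):
an `S`-isomorphism `ℤⁿ_A ≅ ℤⁿ_B` is an additive automorphism of `ℤⁿ` commuting with the action of
`α`, i.e. a unimodular `P` with `P A = B P`. (This is the last step of
`exists_isUnit_det_and_mul_eq_mul_of_isPrincipalIdealRing` in `LatimerMacDuffee.lean`, isolated.) [cite: Taussky1949, Theorems 2–3] -/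
theorem exists_isUnit_det_of_linearEquiv
    (e : QuotModule f A hA ≃ₗ[AdjoinRoot f] QuotModule f B hB) :
    ∃ P : _root_.Matrix (Fin n) (Fin n) ℤ, IsUnit P.det ∧ P * A = B * P := by
  let g : (Fin n → ℤ) ≃ₗ[ℤ] (Fin n → ℤ) :=
    (of f A hA).trans (e.toAddEquiv.toIntLinearEquiv.trans (of f B hB).symm)
  have hgv : ∀ v, of f B hB (g v) = e (of f A hA v) := fun v =>
    (of f B hB).apply_symm_apply _
  have hg : ∀ v, g (A.mulVec v) = B.mulVec (g v) := by
    intro v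
    apply (of f B hB).injective
    rw [hgv, ← root_smul_of, e.map_smul, ← hgv, root_smul_of]
  refine ⟨LinearMap.toMatrix' g.toLinearMap, ?_, ?_⟩
  · have h : LinearMap.toMatrix' g.toLinearMap * LinearMap.toMatrix' g.symm.toLinearMap = 1 := by
      rw [← LinearMap.toMatrix'_comp]
      convert LinearMap.toMatrix'_id
      ext v
      simp
    exact Matrix.isUnit_det_of_right_inverse h
  · refine Matrix.toLin'.injective (LinearMap.ext fun v => ?_)
    simp only [Matrix.toLin'_apply, ← Matrix.mulVec_mulVec, LinearMap.toMatrix'_mulVec,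
      LinearEquiv.coe_coe]
    exact hg v

/-! ### The module of a matrix is an ideal (Taussky's Theorem 1) -/

section Ideal

variable [Fact f.Monic] [IsDomain (AdjoinRoot f)]

omit [IsDomain (AdjoinRoot f)] in
/-- A non-zero integer is non-zero in `ℤ[X]/(f)` (`f` monic of positive degree). [folklore] -/
theorem algebraMap_int_ne_zero (hdeg : f.natDegree = n) (hn : n ≠ 0) {d : ℤ} (hd : d ≠ 0) :
    (algebraMap ℤ (AdjoinRoot f) d) ≠ 0 := by
  rw [AdjoinRoot.algebraMap_eq, ← AdjoinRoot.mk_C]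
  refine AdjoinRoot.mk_ne_zero_of_natDegree_lt (Fact.out : f.Monic) (C_ne_zero.mpr hd) ?_
  rw [natDegree_C, hdeg]
  exact Nat.pos_of_ne_zero hn

/-- **The cyclic vectors `e₀, A e₀, …` span a sublattice of finite index** (`f` irreducible): there
is an integer `d ≠ 0` with `d ℤⁿ ⊆ ℤ[A] e₀`, i.e. every `d v` is `p(A) e₀` for a polynomial `p`.
Proof: `d` is the determinant of the matrix `Q` with columns `Aᵏ e₀`; if it vanished, a non-zero
integer vector in the kernel of `Q` would give `p(A) e₀ = 0` with `p ≠ 0` of degree `< n`, so that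
`[p] ≠ 0` annihilates the non-zero element `e₀` of the torsion-free `S`-module `ℤⁿ_A`; and
`d v = Q (adj Q) v`. [cite: Taussky1949, Theorem 1 (proof)] -/
theorem exists_int_smul_eq_aeval_mulVec (hA : aeval A f = 0) (hdeg : f.natDegree = n)
    (hn : n ≠ 0) :
    ∃ d : ℤ, d ≠ 0 ∧ ∀ v : Fin n → ℤ, ∃ p : ℤ[X],
      d • v = (aeval A p).mulVec (Pi.single (⟨0, Nat.pos_of_ne_zero hn⟩ : Fin n) 1) := by
  classical
  set e₀ : Fin n → ℤ := Pi.single (⟨0, Nat.pos_of_ne_zero hn⟩ : Fin n) 1 with he₀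
  -- the matrix with columns `A^k e₀`
  set Q : _root_.Matrix (Fin n) (Fin n) ℤ := Matrix.of fun i k => ((A ^ (k : ℕ)).mulVec e₀) i
    with hQ
  -- `Q c = (Σ c_k X^k)(A) e₀`
  have hQc : ∀ c : Fin n → ℤ,
      Q.mulVec c = (aeval A (∑ k : Fin n, C (c k) * X ^ (k : ℕ))).mulVec e₀ := by
    intro c
    rw [map_sum, Matrix.sum_mulVec]
    ext i
    simp only [hQ, Matrix.mulVec, dotProduct, Matrix.of_apply, Finset.sum_apply, map_mul,
      aeval_C, map_pow, aeval_X, Algebra.algebraMap_eq_smul_one, smul_mul_assoc, one_mul,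
      Matrix.smul_mulVec, Pi.smul_apply, smul_eq_mul]
    refine Finset.sum_congr rfl fun k _ => ?_
    ring
  -- `det Q ≠ 0`
  have hdet : Q.det ≠ 0 := by
    intro hdet0
    obtain ⟨c, hc0, hQc0⟩ := Matrix.exists_mulVec_eq_zero_iff.mpr hdet0
    set p : ℤ[X] := ∑ k : Fin n, C (c k) * X ^ (k : ℕ) with hp
    have hp0 : p ≠ 0 := by
      intro hp0
      apply hc0
      ext k
      have hk : p.coeff k = c k := by
        rw [hp, finsetSum_coeff]
        simp only [coeff_C_mul_X_pow]
        rw [Finset.sum_eq_single k]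
        · simp
        · intro j _ hjk
          rw [if_neg]
          exact fun h => hjk (Fin.ext h.symm)
        · intro h
          exact absurd (Finset.mem_univ k) h
      rw [← hk, hp0, coeff_zero, Pi.zero_apply]
    have hpdeg : p.natDegree < f.natDegree := by
      rw [hdeg]
      have := degree_sum_fin_lt c
      rw [← hp] at this
      exact (natDegree_lt_iff_degree_lt hp0).mpr this
    have hmk : AdjoinRoot.mk f p ≠ 0 :=
      AdjoinRoot.mk_ne_zero_of_natDegree_lt (Fact.out : f.Monic) hp0 hpdeg
    have he0 : of f A hA e₀ ≠ 0 := by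
      refine of_ne_zero fun h => ?_
      have := congrFun h (⟨0, Nat.pos_of_ne_zero hn⟩ : Fin n)
      simp [he₀] at this
    have : AdjoinRoot.mk f p • of f A hA e₀ = 0 := by
      rw [mk_smul_of, ← hQc, hQc0, map_zero]
    rcases smul_eq_zero.mp this with h | h
    · exact hmk h
    · exact he0 h
  refine ⟨Q.det, hdet, fun v => ⟨∑ k : Fin n, C ((Q.adjugate.mulVec v) k) * X ^ (k : ℕ), ?_⟩⟩
  rw [← hQc, Matrix.mulVec_mulVec, Matrix.mul_adjugate, Matrix.smul_mulVec, Matrix.one_mulVec]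

/-- **Taussky's Theorem 1: the module of a matrix is an ideal.** For `f` monic of degree `n ≥ 1`
with `ℤ[X]/(f)` a domain and `f(A) = 0`, the `ℤ[X]/(f)`-module `ℤⁿ_A` is isomorphic to a non-zero
ideal `J` of `ℤ[X]/(f)` ("to every matrix solution … corresponds an ideal `𝔞 = (ω₁, …, ωₙ)` with
`α ωᵢ = Σ xᵢₖ ωₖ`"). Proof: `s ↦ s • e₀` is an injective `S`-linear map `S → ℤⁿ_A`
(torsion-freeness) whose image contains `d ℤⁿ_A` (`exists_int_smul_eq_aeval_mulVec`), so
`m ↦ (s ↦ s • e₀)⁻¹ (d • m)` is an injective `S`-linear map `ℤⁿ_A → S`. [cite: Taussky1949, Theorem 1] -/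
theorem exists_linearEquiv_ideal (hdeg : f.natDegree = n) (hn : n ≠ 0) :
    ∃ J : Ideal (AdjoinRoot f), J ≠ ⊥ ∧ Nonempty (QuotModule f A hA ≃ₗ[AdjoinRoot f] J) := by
  classical
  obtain ⟨d, hd, hdv⟩ := exists_int_smul_eq_aeval_mulVec (A := A) hA hdeg hn
  set e₀ : Fin n → ℤ := Pi.single (⟨0, Nat.pos_of_ne_zero hn⟩ : Fin n) 1 with he₀
  set m₀ : QuotModule f A hA := of f A hA e₀ with hm₀
  have hm0 : m₀ ≠ 0 := by
    refine of_ne_zero fun h => ?_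
    have := congrFun h (⟨0, Nat.pos_of_ne_zero hn⟩ : Fin n)
    simp [he₀] at this
  -- `ι : s ↦ s • m₀`, injective
  set ι : AdjoinRoot f →ₗ[AdjoinRoot f] QuotModule f A hA := LinearMap.toSpanSingleton _ _ m₀
    with hι
  have hιinj : Function.Injective ι := fun s s' h => smul_left_injective _ hm0 h
  -- `d • m ∈ range ι`
  set dS : AdjoinRoot f := algebraMap ℤ (AdjoinRoot f) d with hdS
  have hdS0 : dS ≠ 0 := algebraMap_int_ne_zero hdeg hn hd
  have hrange : ∀ m : QuotModule f A hA, dS • m ∈ LinearMap.range ι := by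
    intro m
    obtain ⟨v, rfl⟩ := (of f A hA).surjective m
    obtain ⟨p, hp⟩ := hdv v
    refine ⟨AdjoinRoot.mk f p, ?_⟩
    rw [hι, LinearMap.toSpanSingleton_apply, hm₀, mk_smul_of, ← hp, map_zsmul, hdS,
      algebraMap_int_smul]
  -- the injective `S`-linear map `ℤⁿ_A → S`
  let g : QuotModule f A hA →ₗ[AdjoinRoot f] AdjoinRoot f :=
    (LinearEquiv.ofInjective ι hιinj).symm.toLinearMap ∘ₗ
      LinearMap.codRestrict (LinearMap.range ι) (dS • LinearMap.id) hrange
  have hginj : Function.Injective g := by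
    intro x y hxy
    have h1 : (LinearMap.codRestrict (LinearMap.range ι) (dS • LinearMap.id) hrange) x =
        (LinearMap.codRestrict (LinearMap.range ι) (dS • LinearMap.id) hrange) y :=
      (LinearEquiv.ofInjective ι hιinj).symm.injective hxy
    have h2 := congrArg Subtype.val h1
    simp only [LinearMap.codRestrict_apply, LinearMap.smul_apply, LinearMap.id_apply] at h2
    exact (smul_right_injective _ hdS0) h2
  refine ⟨LinearMap.range g, ?_, ⟨LinearEquiv.ofInjective g hginj⟩⟩
  intro hbot
  have : g m₀ = 0 := by
    have hm : g m₀ ∈ LinearMap.range g := ⟨m₀, rfl⟩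
    rw [hbot] at hm
    exact (Submodule.mem_bot _).mp hm
  exact hm0 (hginj (by rw [this, map_zero]))

/-- **A non-zero `S`-linear map `ℤⁿ_A → S` is injective** (because `ℤⁿ_A` is isomorphic to a
non-zero ideal of the domain `S`, and for an ideal `J` a linear `h : J → S` satisfies
`j₀ h(j) = j h(j₀)`). [cite: Taussky1949, Theorem 1] -/
theorem injective_of_ne_zero (hdeg : f.natDegree = n) (hn : n ≠ 0)
    (g : QuotModule f A hA →ₗ[AdjoinRoot f] AdjoinRoot f) (hg : g ≠ 0) :
    Function.Injective g := by
  obtain ⟨J, -, ⟨e⟩⟩ := exists_linearEquiv_ideal (A := A) (hA := hA) hdeg hn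
  -- a witness of `g ≠ 0`
  obtain ⟨m₁, hm₁⟩ : ∃ m, g m ≠ 0 := by
    by_contra h
    exact hg (LinearMap.ext fun m => not_not.mp fun hm => h ⟨m, hm⟩)
  rw [← LinearMap.ker_eq_bot, Submodule.eq_bot_iff]
  intro m hm
  rw [LinearMap.mem_ker] at hm
  -- transport to the ideal: `j₁ • x = x_val • e.symm? ` — compare `(e m : S) • m₁` and `(e m₁ : S) • m`
  have key : ((e m : J) : AdjoinRoot f) • m₁ = ((e m₁ : J) : AdjoinRoot f) • m := by
    apply e.injective
    apply Subtype.ext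
    rw [map_smul, map_smul, Submodule.coe_smul, Submodule.coe_smul, smul_eq_mul, smul_eq_mul,
      mul_comm]
  have h := congrArg g key
  rw [map_smul, map_smul, hm, smul_zero, smul_eq_mul] at h
  rcases mul_eq_zero.mp h with h0 | h0
  · have : (e m : J) = 0 := Subtype.ext h0
    exact e.injective (by rw [this, map_zero])
  · exact absurd h0 hm₁

end Ideal

/-! ### The `S`-linear map attached to elements `β₁, …, βₙ` with `α βⱼ = Σᵢ Aᵢⱼ βᵢ` -/

/-- **The map of a "basis"**: given `β : Fin n → S` with `α βⱼ = Σᵢ Aᵢⱼ βᵢ` (Taussky's relation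
`α(ω) = X(ω)` for the TRANSPOSED convention used by `QuotModule`, where `α` acts on columns as
`A`), the map `v ↦ Σⱼ vⱼ βⱼ` is `S`-linear `ℤⁿ_A → S`; its image is the `ℤ`-span of the `βⱼ`. [cite: Taussky1949, Theorem 1] -/
def toRing (β : Fin n → AdjoinRoot f)
    (hβ : ∀ j, AdjoinRoot.root f * β j = ∑ i, (A i j : AdjoinRoot f) * β i) :
    QuotModule f A hA →ₗ[AdjoinRoot f] AdjoinRoot f :=
  lift
    { toFun := fun v => ∑ j, (v j : AdjoinRoot f) * β j
      map_zero' := by simp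
      map_add' := fun v w => by
        simp only [Pi.add_apply, Int.cast_add, add_mul]
        rw [Finset.sum_add_distrib] }
    (by
      intro v
      change ∑ j, ((A.mulVec v) j : AdjoinRoot f) * β j =
        AdjoinRoot.root f • ∑ j, (v j : AdjoinRoot f) * β j
      simp only [Matrix.mulVec, dotProduct, Int.cast_sum, Int.cast_mul, Finset.sum_mul,
        smul_eq_mul, Finset.mul_sum]
      rw [Finset.sum_comm]
      refine Finset.sum_congr rfl fun i _ => ?_
      rw [mul_left_comm, hβ i, Finset.mul_sum]
      refine Finset.sum_congr rfl fun j _ => ?_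
      ring)

/-- `toRing β hβ v = Σⱼ vⱼ βⱼ`. [folklore] -/
@[simp] theorem toRing_of (β : Fin n → AdjoinRoot f)
    (hβ : ∀ j, AdjoinRoot.root f * β j = ∑ i, (A i j : AdjoinRoot f) * β i) (v : Fin n → ℤ) :
    toRing (hA := hA) β hβ (of f A hA v) = ∑ j, (v j : AdjoinRoot f) * β j :=
  lift_of _ _ v

end QuotModule

/-! ### Ideals in the same class are isomorphic modules -/

/-- **Ideals in the same class are isomorphic modules**: over a commutative domain, if
`(x) I = (y) J` with `x, y ≠ 0` then `I ≅ J` (multiply by `x`, then divide by `y`). This is how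
"the same ideal class" is consumed on the matrix side of the correspondence. [cite: Taussky1949, Theorem 2] -/
def linearEquivOfSpanSingletonMulEq {R : Type*} [CommRing R] [IsDomain R] {I J : Ideal R}
    {x y : R} (hx : x ≠ 0) (hy : y ≠ 0) (h : Ideal.span {x} * I = Ideal.span {y} * J) :
    I ≃ₗ[R] J := by
  have hxinj : Function.Injective (LinearMap.mulLeft R x) := mul_right_injective₀ hx
  have hyinj : Function.Injective (LinearMap.mulLeft R y) := mul_right_injective₀ hy
  have hmap : ∀ (z : R) (L : Ideal R),
      Submodule.map (LinearMap.mulLeft R z) L = Ideal.span {z} * L := by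
    intro z L
    ext w
    simp [Submodule.mem_map, LinearMap.mulLeft_apply, Ideal.mem_span_singleton_mul]
  have heq : Submodule.map (LinearMap.mulLeft R x) I = Submodule.map (LinearMap.mulLeft R y) J := by
    rw [hmap, hmap, h]
  exact (Submodule.equivMapOfInjective _ hxinj I).trans
    ((LinearEquiv.ofEq _ _ heq).trans (Submodule.equivMapOfInjective _ hyinj J).symm)

/-- A module isomorphic to the ring is "principal": if `e : R ≅ J` for an ideal `J` then
`J = (e 1)`. [folklore] -/
theorem ideal_eq_span_of_linearEquiv {R : Type*} [CommRing R] {J : Ideal R} (e : R ≃ₗ[R] J) :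
    J = Ideal.span {((e 1 : J) : R)} := by
  apply le_antisymm
  · intro j hj
    obtain ⟨r, hr⟩ := e.surjective ⟨j, hj⟩
    have : j = r * ((e 1 : J) : R) := by
      have h1 : e r = r • e 1 := by rw [← map_smul, smul_eq_mul, mul_one]
      have h2 := congrArg Subtype.val hr
      rw [h1, Submodule.coe_smul, smul_eq_mul] at h2
      exact h2.symm
    rw [this]
    exact Ideal.mul_mem_left _ _ (Ideal.mem_span_singleton_self _)
  · rw [Ideal.span_singleton_le_iff_mem]
    exact (e 1).2

end Literature.LinearAlgebra.Matrix

end
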